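/- Copyright: the b2b-balaban cell (near-miss cell 7), T⁴-continuum fan-out, row NE7b owner lineage
`b2b-balaban-t4-ne7b-p1` (gen 23), node U5c COUNT member.  Released under the licence of the surrounding project. -/
import Summits.QuantumFields.BalabanUV.T4Continuum.Support.HistoryRealiseCellsRunHeadline

/-!
# Realised histories: the apex and the headline from count-road witnesses ON A COUPLING WINDOW

Summits-side support leaf of the T⁴-continuum cell (rung (B)+1 on a FINITE torus only; NOT infinite volume, NOT the
mass gap, NOT the Clay statement; NOT a proof of the spine estimate NE7b).  Row S12 ∕ node A12-I of the claim table
`t4/b2b-balaban-t4-ne7b-p1/LEAVES-NE7b.md` (owner sub-row S12g «APEX», file 4).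

WHAT.  `HistoryRealiseCellsRunApex.hybridNE7Under_of_countRoad` and `HistoryRealiseCellsRunHeadline.continuumYM4Torus_of_countRoad`
ask for a `CountRoadWitness` at EVERY tuned run `(γ, g, g₀)`; but H3 — Bałaban's final-scale expansion and its price
sentence — is claimed for SMALL couplings only.  This file states the honest WINDOWED forms: the witnesses are asked only
for runs tuned within `]0, γ]` to `g` with `γ ≤ γH`, `g ≤ gH` for SOME positive window `(γH, gH)`; the apex thresholds
become `min γ₁ γH`, `min g₁ gH`:  **`hybridNE7Under_of_countRoad_window`**, **`limit_exists_unique_of_countRoad_window`**,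
and for (0.4)-block-averaged `SU(N)` data **`continuumYM4Torus_of_countRoad_window`**.  [folklore] composition by
name; no `def`, no `[cite:]` tag, nothing printed asserted.

HONEST READING.  `ContinuumYM4Torus D ⇐ (B) ∧ BetaPertHyp ∧ [on a coupling window: ∀ tuned run ∀ loop string, a
count-road witness]`; the witness DISPLAYS H3 (realised reading, costs, printed-currency price sentence, numerator
readings), the E1∕E2 representation, the (B)-side data, NE7c's `ShellWeightBound`, NE7's `ReindexedBudget` and four rates —
hypothesis shapes, none in print, none a theorem of the tree; NOTHING of them is discharged; spine 0∕9 UNCHANGED.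
HONEST DEPENDENCY (cell): continuum YM on T⁴ ⇐ BetaPertH ∧ nine spine estimates (0/9 proved); BetaPertH ⇐ (D1) ∧ (D4) ∧
CAP+tail; G-an2-4 gates asym, D1 and NE2/3/4.  This file changes none of it. -/

open Literature.MathematicalPhysics.QuantumFieldTheory.Balaban1983to89
open T4Continuum T4PrintedShapeBanking T4CanonicalMenus
open Summit.QuantumFields.BalabanUV.T4Continuum.CountThresholdUniform
open Summit.QuantumFields.BalabanUV.T4Continuum.HistoryConstants
open Summit.QuantumFields.BalabanUV.T4Continuum.HistoryRealiseCellsRunPinned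
open Summit.QuantumFields.BalabanUV.T4Continuum.HistoryRealiseCellsRunApex

namespace Summit.QuantumFields.BalabanUV.T4Continuum.HistoryRealiseCellsRunWindow

section Window

variable {F : T4Family} {G : Type*} [GaugeGroup G] [MeasurableSpace G] [HaarData G] [RegularGaugeGroup G]

/-- **ROW NE7b AT THE APEX, WINDOWED FORM.**  As `hybridNE7Under_of_countRoad`, but the count-road witnesses are asked
only for runs tuned within `]0, γ]` to `g` with `γ ≤ γH`, `g ≤ gH` for SOME positive window `(γH, gH)` — the honest shape
of H3.  The apex thresholds are `min γ₁ γH`, `min g₁ gH`, `γ₁, g₁` those of the pinned END. [folklore] -/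
theorem hybridNE7Under_of_countRoad_window (D : FiniteEpsData F G) (hM : D.AvgMeasurable)
    (hsign : B16.SignConventions D.C) {C : T4PrintedShapeBanking.Consts} {O : PrintedO1s} (hD : Dominates C O)
    {rr : ℕ} {β₀ : ℝ} (h : ThresholdOK C F.L rr β₀) (hμ : 0 < C.μ) (d n : ℕ)
    (hκ₁ : (d : ℝ) * Real.log F.L + 2 * Real.log 2 ≤ C.κ₁) (hE₀ : Real.log (2 + birthMass C) ≤ C.E₀)
    (hβ₀ : 0 < β₀) (hLβ : (F.L : ℝ) * β₀ ≤ 1) (hn₁ : 13 ≤ C.n₁) (hn : 0 < n)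
    (hData : ∃ γH : ℝ, 0 < γH ∧ ∃ gH : ℝ, 0 < gH ∧ ∀ (γ g : ℝ) (g₀ : ℕ → ℝ), 0 < γ → γ ≤ γH → 0 < g → g ≤ gH →
      D.Tuned γ g g₀ → ∀ os : List (ULoop F), ∃ (ι α π : Type) (_ : DecidableEq ι) (_ : DecidableEq α)
        (_ : DecidableEq π), Nonempty (CountRoadWitness D C O rr d n g₀ os ι α π)) :
    T4ApexHybrid.HybridNE7Under D (BetaPertHyp D.βfun) := by
  intro hB hβ
  obtain ⟨γH, hγH, gH, hgH, hW⟩ := hData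
  obtain ⟨γ₁, hγ₁, H⟩ := hybridNE7_of_realisedDomainsRun_pinned D hB hβ hsign hD h hμ d n hκ₁ hE₀ hβ₀ hLβ
    hn₁ hn
  refine ⟨min γ₁ γH, lt_min hγ₁ hγH, fun γ hγ hγle => ?_⟩
  obtain ⟨g₁, hg₁, Hg⟩ := H γ hγ (hγle.trans (min_le_left _ _))
  refine ⟨min g₁ gH, lt_min hg₁ hgH, fun g hg hgle g₀ ht os => ?_⟩
  obtain ⟨Em, -, HE⟩ := Hg g hg (hgle.trans (min_le_left _ _))
  obtain ⟨ι, α, π, _, _, _, ⟨X⟩⟩ :=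
    hW γ g g₀ hγ (hγle.trans (min_le_right _ _)) hg (hgle.trans (min_le_right _ _)) ht os
  have hm : ∀ K o, Measurable ((D.scheme g₀).obs K o) := fun K o => D.measurable_avgObs hM K o
  have h1 : ∀ K o U, |(D.scheme g₀).obs K o U| ≤ 1 := fun K o U => D.abs_avgObs_le_one K o U
  obtain ⟨K₁, K₂, hK₁, hH⟩ := HE g₀ ht X.l₀ X.vol X.K₀ X.T X.A X.A' X.shA X.shB X.dead X.dead' X.nup X.mup X.Nup
    X.Cc X.Rr X.CcRec X.RrRec X.ν X.u X.s₂ X.q₀ X.r X.s X.Wsh (fun K => T4GenFunBounds.prodObs (D.scheme g₀) K os) 1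
    (fun K => T4GenFunBounds.measurable_prodObs (D.scheme g₀) hm K os)
    (fun K U => T4GenFunBounds.abs_prodObs_le_one (D.scheme g₀) h1 K os U)
    (fun K t ht hK => (X.reprA K t ht hK).le) (fun K t ht hK => (X.reprB K t ht hK).le) X.c₀ X.n₁ X.c₀_pos X.floor
    X.floor' X.sites X.sites' X.Nup_nonneg X.nup_bd X.mup_bd X.R X.isRj X.one_le_R X.ped X.cellP X.liveC X.Zd X.realised
    X.κ X.κ' X.cost_le X.cost_le' X.Fc X.Rf X.Fc' X.Rf' X.price X.price' X.up X.dead_nonneg X.resum X.F_nonneg X.up'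
    X.dead'_nonneg X.resum' X.F'_nonneg X.shell X.budget X.sum_r X.sum_u X.sum_s X.sum_s₂
  exact ⟨X.l₀, X.vol, K₁ + K₂, X.l₀_pos, X.vol_pos, stringHybridNE7_of_hybridNE7 D X hK₁ hH⟩

/-- **COROLLARY (windowed): EXISTENCE AND UNIQUENESS** of the continuum limit of every joint expectation of unit-scale
averaged loop variables, under the prefix, given count-road witnesses on a coupling window (any gauge group with the
tree's instances; `D.AvgMeasurable`).  CONDITIONAL; NE7b NOT proved. [folklore] -/
theorem limit_exists_unique_of_countRoad_window (D : FiniteEpsData F G) (hM : D.AvgMeasurable)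
    (hsign : B16.SignConventions D.C) {C : T4PrintedShapeBanking.Consts} {O : PrintedO1s} (hD : Dominates C O)
    {rr : ℕ} {β₀ : ℝ} (h : ThresholdOK C F.L rr β₀) (hμ : 0 < C.μ) (d n : ℕ)
    (hκ₁ : (d : ℝ) * Real.log F.L + 2 * Real.log 2 ≤ C.κ₁) (hE₀ : Real.log (2 + birthMass C) ≤ C.E₀)
    (hβ₀ : 0 < β₀) (hLβ : (F.L : ℝ) * β₀ ≤ 1) (hn₁ : 13 ≤ C.n₁) (hn : 0 < n)
    (hData : ∃ γH : ℝ, 0 < γH ∧ ∃ gH : ℝ, 0 < gH ∧ ∀ (γ g : ℝ) (g₀ : ℕ → ℝ), 0 < γ → γ ≤ γH → 0 < g → g ≤ gH →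
      D.Tuned γ g g₀ → ∀ os : List (ULoop F), ∃ (ι α π : Type) (_ : DecidableEq ι) (_ : DecidableEq α)
        (_ : DecidableEq π), Nonempty (CountRoadWitness D C O rr d n g₀ os ι α π)) :
    D.ym4_torus_continuum_limit_exists ∧ D.ym4_torus_continuum_limit_unique :=
  ⟨T4ApexHybrid.limit_exists_of_hybridNE7Under D hM
      (hybridNE7Under_of_countRoad_window D hM hsign hD h hμ d n hκ₁ hE₀ hβ₀ hLβ hn₁ hn hData),
    T4ApexHybrid.limit_unique_of_hybridNE7Under D hM
      (hybridNE7Under_of_countRoad_window D hM hsign hD h hμ d n hκ₁ hE₀ hβ₀ hLβ hn₁ hn hData)⟩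

end Window

section SUWindow

variable {F : T4Family} {N : ℕ} [NeZero N] {ℰ : LoopAverage (Matrix.specialUnitaryGroup (Fin N) ℂ)}

/-- **THE HEADLINE PREDICATE FROM THE COUNT ROAD, WINDOWED**: `ContinuumYM4Torus D` for (0.4)-block-averaged `SU(N)`
data, GIVEN the pins `(B)`, `BetaPertHyp` BY NAME, the sign conventions, the constants' side conditions, and a
`CountRoadWitness` for every run tuned inside SOME coupling window and every loop string.  Honest reading in the module
docstring; nothing inside the witness is discharged; NE7b NOT proved; 0∕9. [folklore] -/
theorem continuumYM4Torus_of_countRoad_window (D : FiniteEpsData F (Matrix.specialUnitaryGroup (Fin N) ℂ))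
    (hBA : D.IsBlockAveraged ℰ) (hE : ℰ.MeasurableE)
    (hB : B16.EndStatementBPrinted D.C) (hβ : BetaPertHyp D.βfun) (hsign : B16.SignConventions D.C)
    {C : T4PrintedShapeBanking.Consts} {O : PrintedO1s} (hD : Dominates C O)
    {rr : ℕ} {β₀ : ℝ} (h : ThresholdOK C F.L rr β₀) (hμ : 0 < C.μ) (d n : ℕ)
    (hκ₁ : (d : ℝ) * Real.log F.L + 2 * Real.log 2 ≤ C.κ₁) (hE₀ : Real.log (2 + birthMass C) ≤ C.E₀)
    (hβ₀ : 0 < β₀) (hLβ : (F.L : ℝ) * β₀ ≤ 1) (hn₁ : 13 ≤ C.n₁) (hn : 0 < n)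
    (hData : ∃ γH : ℝ, 0 < γH ∧ ∃ gH : ℝ, 0 < gH ∧ ∀ (γ g : ℝ) (g₀ : ℕ → ℝ), 0 < γ → γ ≤ γH → 0 < g → g ≤ gH →
      D.Tuned γ g g₀ → ∀ os : List (ULoop F), ∃ (ι α π : Type) (_ : DecidableEq ι) (_ : DecidableEq α)
        (_ : DecidableEq π), Nonempty (CountRoadWitness D C O rr d n g₀ os ι α π)) :
    T4ContinuumYM4Torus.ContinuumYM4Torus D :=
  T4ContinuumYM4Torus.continuumYM4Torus_of_targets hB hβ
    (T4ApexHybrid.targets_of_hybridNE7Under hBA hE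
      (hybridNE7Under_of_countRoad_window D (hBA.avgMeasurable hE) hsign hD h hμ d n hκ₁ hE₀ hβ₀ hLβ hn₁ hn hData))

end SUWindow

end Summit.QuantumFields.BalabanUV.T4Continuum.HistoryRealiseCellsRunWindow
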